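import Mathlib
import Literature.NumberTheory.Automorphic.GaloisActionPlaces
import Literature.NumberTheory.GaloisRepresentations.FrobeniusDensityTheorem
import Literature.NumberTheory.Automorphic.AutomorphicInductionCharacterCubic
import Summits.Langlands.Langlands.Theorems.PicardMuOrdinaryResidualAutomorphyEvenMilestone

/-!
# A place where `ε` separates two conjugate places of degree one (the cuspidality datum)

Helper file for item stmt-Langlands-13760 (route `PicardMuOrdinary`).  The named facts of the tree on
automorphic induction through a cubic extension (`automorphicInduction_character_cubic`,
`automorphicInduction_unitaryCharacter_cubic`) ask, for cuspidality of `AI(θ)`, for a place `v` of the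
base and two places `w ≠ w'` of the cubic field above `v` of the same residue degree, unramified for
`θ`, with `θ(ϖ_w) ≠ θ(ϖ_{w'})`.  For `θ = ε` (the `Epsilon` file) such a datum sits at every good `v`
whose Frobenius in `Gal(M/K)` is a **double transposition** on the roots (three places of degree `1`,
values `+1, -1, -1`).  We produce one unconditionally (`exists_datum`) from **Frobenius' density
theorem** in the form proved in the tree
(`hasStrongDirichletDensity_setOf_frobenius_generates`, for the quadratic extension `M / M^{⟨σ⟩}`,
`perm4 σ = (0 1)(2 3)`): there are infinitely many rational primes `p` below a degree-one prime `𝔮` of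
`M^{⟨σ⟩}` inert in `M`, and at a prime `W ∣ 𝔮` of `𝓞 M` the element `σ` is then an arithmetic Frobenius
over `K` as well (`N𝔮 = N(W ∩ 𝓞 K) = p`).  Unconditional.

Finally (`exists_cuspidal_satakePolynomial_eq_table`, CONDITIONAL on the tree's named fact
`Literature.NumberTheory.Automorphic.automorphicInduction_character_cubic`, Jacquet–Piatetski-Shapiro–Shalika
1979 II §§13–14, taken as a hypothesis): combining the datum with the milestone
`eventually_finprod_eq_table`, **there is a cuspidal automorphic representation `π` of `GL₃(𝔸_K)`,
`K = ℚ(ω)`, whose Satake polynomial at almost every finite place `v` is the branch-point table `T(f, v)`**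
— the item's automorphic statement at weight `0` (the item itself asks for a *regular algebraic* `P`
congruent to the table modulo a prime above `3`, which needs an algebraic Hecke character of `E` of
regular infinity type in place of `ε`, resting on further named facts).
-/

set_option linter.dupNamespace false -- project-wide option (lakefile weak.linter.dupNamespace); `Summit.Langlands.Langlands` is the mandated namespace

noncomputable section

namespace Summit.Langlands.Langlands.Theorems.ResidualAutomorphyEven

open Polynomial Equiv Finset NumberField Pairing IsDedekindDomain Filter
open Literature.NumberTheory.GaloisRepresentations Literature.NumberTheory.Automorphic
  Literature.NumberTheory.LFunctions
open scoped Classical Pointwise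

variable {f : ℤ[X]} (h : IsSepQuartic f)

/-! ### The double transposition `(0 1)(2 3)` -/

/-- The double transposition `d₀ = (0 1)(2 3) ∈ S₄`. -/
def d0 : Perm (Fin 4) := Equiv.swap 0 1 * Equiv.swap 2 3

/-- `d₀` is even. -/
theorem sign_d0 : Perm.sign d0 = 1 := by decide +kernel

/-- `d₀ ≠ 1`. -/
theorem d0_ne_one : d0 ≠ 1 := by decide +kernel

/-- `d₀² = 1`. -/
theorem d0_mul_self : d0 * d0 = 1 := by decide +kernel

/-- `d₀` fixes the pairings `0 = {01|23}` and `1 = {02|13}`. -/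
theorem period_d0 : period d0 0 = 1 ∧ period d0 1 = 1 := by decide +kernel

/-- The block signs of `d₀` at the pairings `0` and `1` are `+1` and `-1`. -/
theorem blockSign_d0 : blockSign (d0 ^ period d0 0) 0 = 1 ∧ blockSign (d0 ^ period d0 1) 1 = -1 := by
  decide +kernel

/-- The pairings `0` and `1` lie in different `⟨d₀⟩`-orbits. -/
theorem one_not_mem_orbitFinset_d0 : (1 : Pairing) ∉ orbitFinset d0 0 := by decide +kernel

/-! ### An element `σ ∈ G` acting as `d₀`, and the quadratic subextension `M / M^{⟨σ⟩}` -/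

section Sigma

variable {σ : G f} (hσ : perm4 h σ = d0)

include hσ in
/-- `σ ≠ 1`. -/
theorem sigma_ne_one : σ ≠ 1 := fun h1 => d0_ne_one (by rw [← hσ, h1, map_one])

include hσ in
/-- `σ² = 1`. -/
theorem sigma_mul_self : σ * σ = 1 := perm4_injective h (by rw [map_mul, hσ, map_one, d0_mul_self])

include hσ in
/-- `⟨σ⟩ = {1, σ}`. -/
theorem mem_zpowers_sigma_iff {x : G f} : x ∈ Subgroup.zpowers σ ↔ x = 1 ∨ x = σ := by
  constructor
  · intro hx
    obtain ⟨k, rfl⟩ := Subgroup.mem_zpowers_iff.mp hx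
    have h2 : σ ^ 2 = 1 := by rw [pow_two, sigma_mul_self h hσ]
    rw [zpow_eq_zpow_emod' k h2]
    have hk : k % ((2 : ℕ) : ℤ) = 0 ∨ k % ((2 : ℕ) : ℤ) = 1 := by omega
    rcases hk with hk | hk
    · left; rw [hk, zpow_zero]
    · right; rw [hk, zpow_one]
  · rintro (hx | hx) <;> rw [hx]
    · exact one_mem _
    · exact Subgroup.mem_zpowers _

/-- The fixed field `M^{⟨σ⟩}` of `σ` (reducible, so that Mathlib's `fixedField` API applies verbatim). -/
abbrev Mfix (σ : G f) : IntermediateField K (M f) := IntermediateField.fixedField (Subgroup.zpowers σ)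

/-- The generator of `Gal(M / M^{⟨σ⟩}) ≅ ⟨σ⟩` corresponding to `σ`. -/
def genFix (σ : G f) : M f ≃ₐ[Mfix σ] M f :=
  IntermediateField.subgroupEquivAlgEquiv (Subgroup.zpowers σ) ⟨σ, Subgroup.mem_zpowers σ⟩

/-- `genFix σ` acts as `σ`. -/
theorem genFix_apply (σ : G f) (x : M f) : genFix σ x = σ x := rfl

/-- The inverse of `subgroupEquivAlgEquiv` does not change the underlying automorphism. -/
theorem subgroupEquivAlgEquiv_symm_apply (σ : G f) (φ : M f ≃ₐ[Mfix σ] M f) (x : M f) :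
    ((IntermediateField.subgroupEquivAlgEquiv (Subgroup.zpowers σ)).symm φ : G f) x = φ x := by
  conv_rhs => rw [← MulEquiv.apply_symm_apply (IntermediateField.subgroupEquivAlgEquiv (Subgroup.zpowers σ)) φ]
  rfl

/-- `Gal(M / M^{⟨σ⟩})` is generated by `genFix σ`. -/
theorem mem_zpowers_genFix (σ : G f) (x : M f ≃ₐ[Mfix σ] M f) : x ∈ Subgroup.zpowers (genFix σ) := by
  obtain ⟨y, rfl⟩ := (IntermediateField.subgroupEquivAlgEquiv (Subgroup.zpowers σ)).surjective x
  obtain ⟨k, hk⟩ := Subgroup.mem_zpowers_iff.mp y.2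
  refine Subgroup.mem_zpowers_iff.mpr ⟨k, ?_⟩
  show (IntermediateField.subgroupEquivAlgEquiv (Subgroup.zpowers σ)) ⟨σ, Subgroup.mem_zpowers σ⟩ ^ k = _
  rw [← map_zpow]
  congr 1
  apply Subtype.ext
  rw [SubgroupClass.coe_zpow, hk]

include hσ in
/-- A non-trivial `M^{⟨σ⟩}`-automorphism of `M` acts as `σ`. -/
theorem apply_eq_sigma_of_ne_one {φ : M f ≃ₐ[Mfix σ] M f} (hφ : φ ≠ 1) (x : M f) : φ x = σ x := by
  set y := (IntermediateField.subgroupEquivAlgEquiv (Subgroup.zpowers σ)).symm φ with hy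
  have hy1 : (y : G f) ≠ 1 := by
    intro h1
    apply hφ
    have : y = 1 := Subtype.ext h1
    rw [hy, MulEquiv.map_eq_one_iff] at this
    exact this
  have hyσ : (y : G f) = σ := ((mem_zpowers_sigma_iff h hσ).mp y.2).resolve_left hy1
  rw [← subgroupEquivAlgEquiv_symm_apply σ φ x, ← hy, hyσ]

/-! ### From a degree-one prime of `M^{⟨σ⟩}` inert in `M` to a Frobenius over `K` equal to `σ` -/

include hσ in
/-- **`σ` is an arithmetic Frobenius over `K`** at a prime `W` of `𝓞 M` above a prime `𝔮` of `M^{⟨σ⟩}`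
of prime absolute norm `p` at which every Frobenius generates `Gal(M/M^{⟨σ⟩})`: the Frobenius `φ` of `W`
over `𝔮` is `≠ 1`, hence acts as `σ`, and `N𝔮 = p = N(W ∩ 𝓞 K)`. -/
theorem isArithFrobAt_sigma (hG : IsGalois K (M f)) {q : HeightOneSpectrum (𝓞 (Mfix σ))}
    (hq : ∀ Q ∈ q.asIdeal.primesOver (𝓞 (M f)), ∀ φ : M f ≃ₐ[Mfix σ] M f,
      IsArithFrobAt (𝓞 (Mfix σ)) φ Q → Subgroup.zpowers φ = ⊤)
    {p : ℕ} (hp : p.Prime) (hqp : Ideal.absNorm q.asIdeal = p)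
    (W : Ideal (𝓞 (M f))) [W.IsMaximal] [hWq : W.LiesOver q.asIdeal] :
    IsArithFrobAt (𝓞 K) σ W ∧ Ideal.absNorm (W.under (𝓞 K)) = p := by
  haveI := hG
  -- the Frobenius over `M^{⟨σ⟩}` at `W` is `≠ 1`, hence acts as `σ`
  obtain ⟨φ, hφ⟩ := exists_isArithFrobAt_ringOfIntegers (M := Mfix σ) W (W_ne_bot W)
  have htop := hq W ⟨inferInstance, hWq⟩ φ hφ
  have hφ1 : φ ≠ 1 := by
    intro h1
    rw [h1, Subgroup.zpowers_one_eq_bot] at htop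
    have hgen : genFix σ ∈ (⊥ : Subgroup (M f ≃ₐ[Mfix σ] M f)) := by rw [htop]; exact Subgroup.mem_top _
    rw [Subgroup.mem_bot] at hgen
    apply sigma_ne_one h hσ
    apply AlgEquiv.ext
    intro x
    rw [← genFix_apply σ x, hgen]
    rfl
  -- norms: `N𝔮 = p`, so `N(W ∩ 𝓞 K) = p` and `f(𝔮 | W ∩ 𝓞 K) = 1`
  haveI : q.asIdeal.IsMaximal := q.isMaximal
  haveI : Module.Finite (𝓞 K) (𝓞 (Mfix σ)) := IsIntegralClosure.finite (𝓞 K) K (Mfix σ) (𝓞 (Mfix σ))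
  haveI : (q.asIdeal).LiesOver (q.asIdeal.under (𝓞 K)) := ⟨rfl⟩
  have hpow := Ideal.absNorm_pow_inertiaDeg (q.asIdeal.under (𝓞 K)) q.asIdeal (R := 𝓞 K)
  rw [hqp, hp.pow_eq_iff] at hpow
  have hWK : W.under (𝓞 K) = q.asIdeal.under (𝓞 K) := by rw [hWq.over, Ideal.under_under]
  refine ⟨fun y => ?_, by rw [hWK, hpow.1]⟩
  -- `σ • y - y ^ N(W ∩ 𝓞 K) ∈ W` from `φ • y - y ^ N𝔮 ∈ W`
  have hy := hφ y
  rw [MulSemiringAction.toAlgHom_apply, ← hWq.over, ← Submodule.cardQuot_apply, ← Ideal.absNorm_apply, hqp] at hy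
  rw [MulSemiringAction.toAlgHom_apply, hWK, ← Submodule.cardQuot_apply, ← Ideal.absNorm_apply, hpow.1]
  have hsmul : σ • y = φ • y := by
    apply RingOfIntegers.ext
    rw [Literature.NumberTheory.Automorphic.RingOfIntegers.coe_algEquiv_smul K,
      Literature.NumberTheory.Automorphic.RingOfIntegers.coe_algEquiv_smul (Mfix σ), apply_eq_sigma_of_ne_one h hσ hφ1]
  rw [hsmul]
  exact hy

end Sigma

/-! ### Existence of a good place with Frobenius `d₀` (Frobenius' density theorem) -/

/-- Unpacking `primeNormCount L X p ≠ 0`: some `𝔮 ∈ X` has absolute norm `p`. -/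
theorem exists_mem_of_primeNormCount_ne_zero {L : Type*} [Field L] [NumberField L]
    {X : Set (HeightOneSpectrum (𝓞 L))} {p : ℕ} (hX : primeNormCount L X p ≠ 0) :
    ∃ q ∈ X, Ideal.absNorm q.asIdeal = p := by
  obtain ⟨q, hq⟩ := Finset.card_ne_zero.mp hX
  rw [Finset.mem_filter, mem_primesOfNorm] at hq
  exact ⟨q, hq.2, hq.1⟩

/-- **There is a good place `v` of `K` and a prime `W ∣ v` of `𝓞 M` at which an element `σ ∈ G` with
`perm4 σ = (0 1)(2 3)` is an arithmetic Frobenius.** -/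
theorem exists_good_isArithFrobAt_d0 (h12 : 12 ∣ Nat.card (G f)) (hlc : f.leadingCoeff ≠ 0) :
    ∃ v : HeightOneSpectrum (𝓞 K), v ∉ badSet h ∧ ∃ W : Ideal (𝓞 (M f)), ∃ _ : W.IsMaximal,
      v.asIdeal = W.under (𝓞 K) ∧ ∃ σ : G f, perm4 h σ = d0 ∧ IsArithFrobAt (𝓞 K) σ W := by
  haveI hG := isGalois_M h
  obtain ⟨σ, hσ⟩ := exists_perm4_eq h h12 d0 sign_d0
  -- Frobenius' theorem for the quadratic extension `M / M^{⟨σ⟩}`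
  have hdens := hasStrongDirichletDensity_setOf_frobenius_generates (genFix σ) (mem_zpowers_genFix σ)
  have hc : 0 < ((Nat.totient (orderOf (genFix σ)) : ℝ) / orderOf (genFix σ)) := by
    have ho : 0 < orderOf (genFix σ) := orderOf_pos _
    exact div_pos (Nat.cast_pos.mpr (Nat.totient_pos.mpr ho)) (Nat.cast_pos.mpr ho)
  have hinf := HasPrimeLogAsymp.infinite hdens hc
  -- discard the finitely many rational primes below the bad places of `K`
  have hbadP : ((fun v : HeightOneSpectrum (𝓞 K) => Ideal.absNorm v.asIdeal) '' badSet h).Finite :=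
    (finite_badSet h h12 hlc).image _
  have hfinP : {p : Nat.Primes | (p : ℕ) ∈ (fun v : HeightOneSpectrum (𝓞 K) => Ideal.absNorm v.asIdeal) '' badSet h}.Finite :=
    hbadP.preimage Nat.Primes.coe_nat_injective.injOn
  obtain ⟨p, hp, hpbad⟩ := (Set.Infinite.sdiff hinf hfinP).nonempty
  obtain ⟨q, ⟨-, hgen⟩, hqp⟩ := exists_mem_of_primeNormCount_ne_zero (Nat.cast_ne_zero.mp hp)
  -- a prime `W ∣ 𝔮` of `𝓞 M`; `σ` is a Frobenius over `K` there
  haveI := q.isMaximal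
  obtain ⟨W, hWmax, hWq⟩ := Ideal.exists_maximal_ideal_liesOver_of_isIntegral (S := 𝓞 (M f)) q.asIdeal
  haveI := hWmax
  haveI := hWq
  obtain ⟨hfrob, hnorm⟩ := isArithFrobAt_sigma h hσ hG hgen p.2 hqp W
  refine ⟨(placeW W).under (𝓞 K), fun hbad => hpbad ⟨_, hbad, ?_⟩, W, hWmax, rfl, σ, hσ, hfrob⟩
  show Ideal.absNorm ((placeW W).under (𝓞 K)).asIdeal = p
  rw [HeightOneSpectrum.under_asIdeal]
  exact hnorm

/-! ### The datum -/

/-- **The cuspidality datum for `ε`**: a place `v` of `K` and places `w ≠ w'` of `E` above `v` of the same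
residue degree, unramified for `ε`, with `ε(ϖ_w) ≠ ε(ϖ_{w'})` (namely `w = placeOf 0`, `w' = placeOf 1`
at a good `v` with Frobenius `(0 1)(2 3)`: degrees `1, 1`, values `+1, -1`). -/
theorem exists_datum (h12 : 12 ∣ Nat.card (G f)) (hlc : f.leadingCoeff ≠ 0) :
    ∃ (v : HeightOneSpectrum (𝓞 K)) (w w' : HeightOneSpectrum (𝓞 (E h))), w ≠ w' ∧
      w.under (𝓞 K) = v ∧ w'.under (𝓞 K) = v ∧
      w.asIdeal.inertiaDeg (𝓞 K) = w'.asIdeal.inertiaDeg (𝓞 K) ∧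
      (eps h h12 hlc).IsUnramifiedAt w ∧ (eps h h12 hlc).IsUnramifiedAt w' ∧
      (eps h h12 hlc).valueAtUniformizer w ≠ (eps h h12 hlc).valueAtUniformizer w' := by
  have hG := isGalois_M h
  obtain ⟨v, hv, W, hWmax, hvW, σ, hσ, hfrob⟩ := exists_good_isArithFrobAt_d0 h h12 hlc
  obtain ⟨hunr, h2W, -, -, hsW⟩ := good_of_not_mem_badSet h hv W hvW
  have hD := stabilizer_eq_zpowers W v hvW hG hunr hfrob
  refine ⟨v, placeOf h h12 W v hvW 0, placeOf h h12 W v hvW 1, ?_, placeOf_under _ _ _ _ _ _,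
    placeOf_under _ _ _ _ _ _, ?_, isUnramifiedAt_eps_placeOf h h12 W v hvW hlc 0 h2W hsW,
    isUnramifiedAt_eps_placeOf h h12 W v hvW hlc 1 h2W hsW, ?_⟩
  · rw [Ne, placeOf_eq_placeOf_iff_mem_orbitFinset h h12 W v hvW hG hD, hσ]
    exact one_not_mem_orbitFinset_d0
  · rw [inertiaDeg_placeOf h h12 W v hvW hG hunr σ hD, inertiaDeg_placeOf h h12 W v hvW hG hunr σ hD, hσ,
      period_d0.1, period_d0.2]
  · rw [valueAtUniformizer_placeOf h h12 W v hvW hG hunr hlc hfrob 0 h2W hsW,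
      valueAtUniformizer_placeOf h h12 W v hvW hG hunr hlc hfrob 1 h2W hsW, hσ, blockSign_d0.1, blockSign_d0.2]
    norm_num

/-! ### The automorphic side at weight `0`, granted cubic automorphic induction (JPSS 1979) -/

/-- **Weight-`0` automorphy of the branch-point table, granted cubic automorphic induction.**  For
`f ∈ ℤ[X]` of degree `4`, separable over `ℚ`, with `12 ∣ #Gal(f)` and four real roots, and granting
`automorphicInduction_character_cubic` (JPSS 1979 II), there is a cuspidal automorphic representation
`π` of `GL₃(𝔸_K)` (`K = ℚ(ω)`, Borel–Jacquet data at the compactness witness `hcpt`) such that for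
almost every finite place `v` of `K`, `π` has a Satake parameter `α` at `v` with
`∏_{a ∈ α} (X - a) = T(f, v)` (the route's five-way branch-point table, read in `ℂ[X]`). -/
theorem exists_cuspidal_satakePolynomial_eq_table (hAI : automorphicInduction_character_cubic)
    (f : ℤ[X]) (hcpt : isCompact_glFiniteIntegralLevel 3 K) (hdeg : f.natDegree = 4)
    (hsep : (f.map (Int.castRingHom ℚ)).Separable) (hgal : 12 ∣ Nat.card (f.map (Int.castRingHom ℚ)).Gal)
    (hreal : (f.map (Int.castRingHom ℝ)).roots.card = 4) :
    ∃ π : CuspidalAutomorphicRepData 3 K hcpt,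
      ∀ᶠ v : HeightOneSpectrum (𝓞 K) in cofinite, ∃ α : Multiset ℂ,
        π.1.HasSatakeParamAt v α ∧
          satakePolynomial α =
            (if (fbar f v).roots.toFinset.card = 4 then (X - 1) ^ 3
              else if (fbar f v).roots.toFinset.card = 2 then (X - 1) ^ 2 * (X + 1)
              else if (fbar f v).roots.toFinset.card = 1 then X ^ 3 - 1
              else if (∃ y : 𝓞 K ⧸ v.asIdeal, y ^ 2 = (fbar f v).discr) then (X - 1) * (X + 1) ^ 2
              else X ^ 3 + X ^ 2 + X + 1 : ℤ[X]).map (Int.castRingHom ℂ) := by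
  set h : IsSepQuartic f := isSepQuartic_of_hyp hdeg hsep with hh
  have h12 : 12 ∣ Nat.card (G f) := twelve_dvd_card_G_of_hyp hdeg hsep hgal hreal
  have hlc : f.leadingCoeff ≠ 0 := leadingCoeff_ne_zero_of_hyp hdeg
  obtain ⟨v₀, w, w', hww', hw, hw', hf, hu, hu', hne⟩ := exists_datum h h12 hlc
  obtain ⟨π, hπ⟩ := hAI K (E h) (finrank_E h h12) (eps h h12 hlc) (isFiniteOrder_eps h h12 hlc)
    ⟨v₀, w, w', hww', hw, hw', hf, hu, hu', hne⟩ hcpt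
  refine ⟨π, ?_⟩
  have hmile := (eventually_finprod_eq_table f hdeg hsep hgal hreal).2
  filter_upwards [hπ, hmile] with v hv hv'
  obtain ⟨α, hα, hpoly⟩ := hv
  exact ⟨α, hα, hpoly.trans hv'⟩

end Summit.Langlands.Langlands.Theorems.ResidualAutomorphyEven
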